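import Summits.NavierStokesRegularity.NavierStokesRegularity.Theses.ConservativeEngine
import Summits.NavierStokesRegularity.NavierStokesRegularity.Theorems.EulerZoomLiouvilleConservativeEngineBirthmark

/-!
# N30 «CONSERVATIVE ENGINE» — support item BM `ClassicalBirthmark` CLOSED by the banked kernel theorem

The route item `ConservativeEngine.ClassicalBirthmark` (stmt 27531) is, up to unfolding the item text,
`Theorems.ConservativeEngine.hasLocalEnergyEqualityOn_of_maximal` (p779344; lens-6 g18 §4: a maximal smooth solution obeys CKN (2.5)
WITH EQUALITY on every cylinder inside its life span, for any distributional pressure and weak gradient).  Sources: CKN 1982 §2 (2.5);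
Tao 2011 footnote 3; Duchon–Robert 2000 §4.
-/

namespace Summit.NavierStokesRegularity.NavierStokesRegularity.Theorems

/-- **BM** — the route item `ConservativeEngine.ClassicalBirthmark`, from `hasLocalEnergyEqualityOn_of_maximal`. -/
theorem conservativeEngine_classicalBirthmark_proof : Theses.ConservativeEngine.ClassicalBirthmark :=
  fun _ T hν _ _ hmax _ _ _ _ hrT hsw hG =>
    ConservativeEngine.hasLocalEnergyEqualityOn_of_maximal (T := T) hν hmax hrT hsw hG

end Summit.NavierStokesRegularity.NavierStokesRegularity.Theorems
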